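import Literature.Geometry.Kaehler.ComplexTorusUnimodularSubtorusSplitting
import Literature.Geometry.Kaehler.ComplexTorusKernelImageIsogenyDiagram
import Literature.Geometry.Kaehler.ComplexTorusImageKernel
import Literature.Geometry.Kaehler.ComplexTorusDualExact
import HarnessLib

/-!
# Clemens–Griffiths §3: a morphism of principally polarized complex tori is an embedding onto a direct factor
# (`(W₁, U₁, ℋ₁) ≅ (σ(W₁), σ(U₁), ℋ₂|)` and `(W₂, U₂, ℋ₂) ≅ (σW₁, …) ⊕ (W₁^⊥, U₁^⊥, ℋ₂|)`, (3.6))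

Layer `Literature/Geometry/Kaehler` (GK), namespace `Literature.Geometry.Kaehler.ComplexTorus`; lane `lit-hodgefound`
(Track 2 foundations library; prover seat `lit-hodgefound-p26`, gen 12, row g12-#4). THEOREMS ONLY: no definition,
no named fact.

Sequel of `ComplexTorusUnimodularSubtorusSplitting.lean` (g12-#1 FILE 2), which proved C–G (3.6) for a complex SUBTORUS
`Y = π(V)` of `X = E/Φ(ℤ^ι)` on whose lattice `Λ_Y` the integral lattice form `B` of `η` is unimodular
(`exists_isPolarizedIso_addition_orthSubspace_of_isUnimodular_subLattice`: `(Y, η|) × (Y^⊥, η|) ⥲ (X, η)`), and, at the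
level of LATTICES only, C–G's sentence on morphisms (`mulVec_injective_of_isUnimodular`,
`isCompl_range_mulVecLin_orthogonal`, `isUnimodular_restrict_range_mulVecLin`,
`isUnimodular_restrict_orthogonal_range_mulVecLin`).  Here the morphism itself is treated ON THE TORI, consuming the
tree's homomorphism vocabulary: a homomorphism `ρ(M) : X₁ = E₁/Φ₁(ℤ^{ι₁}) → X = E/Φ(ℤ^ι)` is an integer matrix
`M : Matrix ι ι₁ ℤ` (rational representation) with a `ℂ`-linear analytic representation `F : E₁ →L[ℂ] E`,
`Φ ∘ M_ℝ = F ∘ Φ₁` (`hF`, the hypothesis shape of `ComplexTorus.mapMatrix` / `contMDiff_mapMatrix`); its image is the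
subtorus on `V = range M_ℝ` (`isLatticeSubspace_range_mulVecLin`, `isComplexSubspace_range_mulVecLin`,
`ComplexTorusImageKernel.lean`), its corestriction `X₁ ↠ Im ρ(M)` is `ρ(R_V M)` with analytic representation `F`
corestricted (`analyticRep_retractionMatrix_mul`, `subtorusMatrix_mul_retractionMatrix_mul`,
`ComplexTorusKernelImageIsogenyDiagram.lean`), the kernel criterion is `mapMatrix_injective_iff`
(`ComplexTorusDualExact.lean`), the pulled-back form is `pullbackForm F η` (`ComplexTorusRiemannFormTransport.lean`) and
isomorphisms of polarised tori are `IsPolarizedIso` / `exists_isPolarizedIso_of_matrix` (`SiegelLevelModuli.lean`).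

## Source, verbatim

C. H. Clemens, P. A. Griffiths, *The intermediate Jacobian of the cubic threefold*, Ann. of Math. 95 (1972), §3,
p. 293 (after Def. 3.5): *"In the category of principally polarized complex tori, the notion of morphism will be the
strong one, namely `(W₁, U₁, ℋ₁) → (W₂, U₂, ℋ₂)` means a linear transformation `σ : W₁ → W₂` such that `σ(U₁) ⊆ U₂`
and `ℋ₁ = (ℋ₂)_σ`, the "pullback" of `ℋ₂` under `σ`. This implies that `σ : W₁ → W₂` is injective and that `σ(U₁)`
is a direct summand of `U₂` such that `Im ℋ₂` is also unimodular on `U₁^⊥ = (σ(U₁))^{⊥ Im ℋ₂} ⊆ U₂`. […] we obtain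
a direct sum decomposition (3.6) `(W₁, U₁, ℋ₁) ⊕ (W₁^⊥, U₁^⊥, ℋ₂|_{W₁^⊥}) ≅ (W₂, U₂, ℋ₂)`."*

## Setting and what is proved

`Φ₁ : (ι₁ → ℝ) ≃L[ℝ] E₁`, `Φ : (ι → ℝ) ≃L[ℝ] E` period isomorphisms; `M : Matrix ι ι₁ ℤ`, `F : E₁ →L[ℂ] E` with
`hF : ∀ x, Φ (M_ℝ x) = F (Φ₁ x)`; `η` a real `2`-form on `E` with INTEGRAL lattice form `B` on `Λ = ℤ^ι`
(`hB : (B m n : ℝ) = η(Φm, Φn)`) and `B₁` the integral lattice form of the pull-back `F^*η` on `Λ₁ = ℤ^{ι₁}`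
(`hB₁`); the C–G hypothesis is `h₁ : B₁.IsUnimodular` (`ℋ₁ = (ℋ₂)_σ` unimodular on `U₁`).  No positivity anywhere.

* §1 `map_mulVec_eq_of_pullbackForm` — `M` is isometric for the lattice forms: `B (Mm) (Mn) = B₁ m n`.
* §2 **«`σ` is injective»**: `exists_eq_intVec_of_isUnimodular` — a real vector `x` with `M_ℝ x ∈ Λ` lies in `Λ₁`
  (the functional `B(M_ℝ x, ·)` on `Λ₁` is `B₁(m₁, ·)` by unimodularity, and `F^*η` is non-degenerate since
  `det = ±1`); hence **`mapMatrix_injective_of_isUnimodular`: `ρ(M) : X₁ → X` IS INJECTIVE** (an embedding of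
  complex tori) and `analyticRep_injective_of_isUnimodular`: `F = σ` is injective.
* §3 **«`σ(U₁)` is a direct summand of `U₂`»** on the torus side: `subLattice_range_eq_range_mulVecLin` — the
  lattice `Λ ∩ V` of the image subtorus IS `M(Λ₁)` (primitivity), so `B` is unimodular on it
  (`isUnimodular_restrict_subLattice_range`) and on the lattice of `V^⊥ = (range M_ℝ)^{⊥η}`
  (`isUnimodular_restrict_subLattice_orthSubspace_range`, for `B` unimodular on `Λ`).
* §4 **(3.6), the splitting**: for `η` of type `(1,1)`, `(range M_ℝ, (range M_ℝ)^⊥)` is a product pair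
  (`isProductPair_range_orthSubspace`), so g12-#1's `exists_isPolarizedIso_addition_orthSubspace_of_isUnimodular_subLattice`
  makes the addition map `(Im ρ(M), η|) × (Im^⊥, η|) → (X, η)` an ISOMORPHISM OF POLARISED TORI
  (`isLatticeSubspace_isComplexSubspace_range_orthSubspace` supplies its hypotheses; bundled in §6).
* §5 **(3.6), the identification `(W₁, U₁, ℋ₁) ≅ (σW₁, σU₁, ℋ₂|)`**: the corestriction `ρ(R_V M) : X₁ → Im ρ(M)` is an
  ISOMORPHISM OF POLARISED TORI `(X₁, F^*η) ⥲ (Im ρ(M), η|_{Im})` (`exists_isPolarizedIso_corestriction_of_isUnimodular`: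
  an integer inverse `P` of `R_V M` exists because `M(Λ₁) = Λ ∩ V`).
* §6 `clemensGriffiths_3_6_morphism` — the three conclusions bundled AS PRINTED.
* §7 (equal rank, one index type `ι` on both sides) `transpose_mul_toMatrix'_mul_eq` (`ᵗM G M = G₁`),
  `isUnit_det_of_isUnimodular_of_rank_eq` (`det M = ±1`), `isUnimodular_of_isUnimodular_of_rank_eq`, and
  **`exists_isPolarizedIso_of_isUnimodular_of_rank_eq`: a morphism of principally polarized tori of the same dimension
  is an isomorphism of polarised tori** (`W₁^⊥ = 0` in (3.6)).

## References

* [ClemensGriffiths1972] C. H. Clemens, P. A. Griffiths, The intermediate Jacobian of the cubic threefold, Ann. of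
  Math. (2) 95 (1972) 281–356, §3 Def. 3.5 and (3.6), p. 293.
* [Lange2023AbelianVarietiesComplex] H. Lange, Abelian Varieties over the Complex Numbers, Springer 2023, §1.1.2
  Prop. 1.1.6, Prop. 1.1.10 (image and kernel of a homomorphism), §2.4.4 Cor. 2.4.31 (the positive case).
* [SwinnertonDyer1974AbelianVarieties] H. P. F. Swinnerton-Dyer, Analytic Theory of Abelian Varieties, LMS Lecture
  Note Series 14, CUP 1974, Ch. II §7 Thm. 34 (the corestriction `A₁ → A₃ = Im φ`), pp. 55–57.
-/

noncomputable section

open Module Function Complex Submodule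
open scoped Matrix
open LinearMap (BilinForm)

namespace Literature.Geometry.Kaehler

namespace ComplexTorus

variable {ι₁ ι : Type*} [Fintype ι₁] [Fintype ι] [DecidableEq ι₁] [DecidableEq ι]
  {E₁ E : Type*} [NormedAddCommGroup E₁] [NormedSpace ℂ E₁] [NormedAddCommGroup E] [NormedSpace ℂ E]
  (Φ₁ : (ι₁ → ℝ) ≃L[ℝ] E₁) (Φ : (ι → ℝ) ≃L[ℝ] E) {M : Matrix ι ι₁ ℤ} {F : E₁ →L[ℂ] E}
  {η : E [⋀^Fin 2]→L[ℝ] ℝ} {B : LinearMap.BilinForm ℤ (ι → ℤ)} {B₁ : LinearMap.BilinForm ℤ (ι₁ → ℤ)}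

/-! ### Private plumbing on integer vectors -/

omit [Fintype ι₁] [DecidableEq ι₁] in
/-- `intVec` is injective. Private plumbing. [folklore] -/
private theorem pM_intVec_injective : Injective (intVec : (ι₁ → ℤ) → ι₁ → ℝ) := fun m n h ↦
  funext fun i ↦ by
    have hi : ((m i : ℤ) : ℝ) = n i := congr_fun h i
    exact_mod_cast hi

omit [Fintype ι₁] [DecidableEq ι₁] in
/-- `intVec 0 = 0`. Private plumbing. [folklore] -/
private theorem pM_intVec_zero : intVec (0 : ι₁ → ℤ) = 0 := funext fun _ ↦ by simp [intVec]

/-! ## §1 The lattice forms: `M` is isometric -/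

section Lattice

variable (hF : ∀ x, Φ ((M.map (Int.cast : ℤ → ℝ)) *ᵥ x) = F (Φ₁ x))
  (hB : ∀ m n : ι → ℤ, (B m n : ℝ) = η ![Φ (intVec m), Φ (intVec n)])
  (hB₁ : ∀ m n : ι₁ → ℤ, (B₁ m n : ℝ) = pullbackForm F η ![Φ₁ (intVec m), Φ₁ (intVec n)])
include hF hB hB₁

omit [Fintype ι] [DecidableEq ι₁] [DecidableEq ι] in
/-- **`ℋ₁ = (ℋ₂)_σ` on the lattices: `B (Mm) (Mn) = B₁ m n`** — the rational representation `M` of the morphism is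
isometric for the integral lattice forms of `η` and `F^*η`. [cite: ClemensGriffiths1972, §3, p. 293]
[cite: Lange2023AbelianVarietiesComplex, §1.4.2 Prop. 1.4.6 (d)] -/
theorem map_mulVec_eq_of_pullbackForm (m n : ι₁ → ℤ) : B (M *ᵥ m) (M *ᵥ n) = B₁ m n := by
  have h := hB₁ m n
  rw [pullbackForm_apply, ← hF, ← hF, intVec_mulVec, intVec_mulVec, ← hB] at h
  exact_mod_cast h.symm

/-! ## §2 «This implies that `σ : W₁ → W₂` is injective»: `ρ(M)` is an embedding of complex tori -/

omit [Fintype ι] [DecidableEq ι] in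
/-- **`M_ℝ⁻¹(Λ) = Λ₁`**: if `B₁` (the lattice form of `F^*η`) is unimodular, a real vector `x ∈ Λ₁ ⊗ ℝ` with
`M_ℝ x ∈ Λ` is a lattice vector.  (The integral functional `m ↦ B(M_ℝ x, M m)` on `Λ₁` is `B₁(m₁, ·)` for some
`m₁ ∈ Λ₁` by unimodularity; then `F^*η(x - m₁, Λ₁) = 0`, and `F^*η` is non-degenerate on `Λ₁ ⊗ ℝ` because
`det = ±1`.) [cite: ClemensGriffiths1972, §3, p. 293] [cite: Lange2023AbelianVarietiesComplex, §1.1.2 Prop. 1.1.10 (b)] -/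
theorem exists_eq_intVec_of_isUnimodular (h₁ : B₁.IsUnimodular) {x : ι₁ → ℝ}
    (hx : ∃ n : ι → ℤ, (M.map (Int.cast : ℤ → ℝ)) *ᵥ x = intVec n) : ∃ m : ι₁ → ℤ, x = intVec m := by
  obtain ⟨n, hn⟩ := hx
  have hM := map_mulVec_eq_of_pullbackForm Φ₁ Φ hF hB hB₁
  haveI : B₁.IsPerfPair := h₁
  -- the integral functional `m ↦ B n (M m)` on `Λ₁` is represented by some `m₁`
  obtain ⟨m₁, hm₁⟩ := (LinearMap.IsPerfPair.bijective_left B₁).2 ((B n).comp M.mulVecLin)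
  refine ⟨m₁, ?_⟩
  -- `F^*η (x - m₁, m) = 0` for every lattice vector `m`
  have hzero : ∀ m : ι₁ → ℤ, latticeBilin Φ₁ (pullbackForm F η) (x - intVec m₁) (intVec m) = 0 := by
    intro m
    have hrep := LinearMap.congr_fun hm₁ m
    rw [LinearMap.comp_apply, Matrix.mulVecLin_apply] at hrep
    rw [map_sub, LinearMap.sub_apply, latticeBilin_apply, latticeBilin_apply, pullbackForm_apply,
      pullbackForm_apply, ← hF, ← hF, ← hF, hn, intVec_mulVec, intVec_mulVec, ← hB, ← hB, hM, sub_eq_zero]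
    exact_mod_cast hrep.symm
  -- hence `F^*η (x - m₁, ·) = 0` on `Λ₁ ⊗ ℝ`
  have hfun : latticeBilin Φ₁ (pullbackForm F η) (x - intVec m₁) = 0 := by
    refine (Pi.basisFun ℝ ι₁).ext fun j ↦ ?_
    rw [Pi.basisFun_apply, LinearMap.zero_apply, ← intVec_single, hzero]
  -- and `F^*η` is non-degenerate on `Λ₁ ⊗ ℝ`: `|det| = 1`
  have hdet : (latticeGram Φ₁ (pullbackForm F η)).det ≠ 0 := by
    have h1 := (isUnimodular_iff_abs_polarizationDegree Φ₁ hB₁).1 h₁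
    rw [polarizationDegree_eq_det] at h1
    intro h0
    rw [h0, abs_zero] at h1
    exact zero_ne_one h1
  have hy : x - intVec m₁ = 0 := by
    refine Matrix.eq_zero_of_vecMul_eq_zero hdet (funext fun j ↦ ?_)
    have h := LinearMap.congr_fun hfun (Pi.single j 1)
    rw [LinearMap.zero_apply, latticeBilin_apply, ← dotProduct_latticeGram_mulVec, Matrix.dotProduct_mulVec,
      dotProduct_single, mul_one] at h
    rw [h, Pi.zero_apply]
  exact sub_eq_zero.1 hy

omit [Fintype ι] [DecidableEq ι] in
/-- **`ρ(M) : X₁ → X` IS INJECTIVE** — a morphism of principally polarized complex tori in C–G's sense (`F^*η`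
unimodular on `Λ₁`) is an embedding of complex tori (`Ker ρ(M) = M_ℝ⁻¹(Λ)/Λ₁ = 0`).
[cite: ClemensGriffiths1972, §3, p. 293] [cite: Lange2023AbelianVarietiesComplex, §1.1.2 Prop. 1.1.10 (b)] -/
theorem mapMatrix_injective_of_isUnimodular (h₁ : B₁.IsUnimodular) : Injective (mapMatrix Φ₁ Φ M) :=
  (mapMatrix_injective_iff Φ₁ Φ M).2 fun _ hx ↦ exists_eq_intVec_of_isUnimodular Φ₁ Φ hF hB hB₁ h₁ hx

omit [Fintype ι] [DecidableEq ι] in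
/-- **«`σ : W₁ → W₂` is injective»**: the analytic representation `F` is injective.
[cite: ClemensGriffiths1972, §3, p. 293] -/
theorem analyticRep_injective_of_isUnimodular (h₁ : B₁.IsUnimodular) : Injective F := by
  refine (injective_iff_map_eq_zero F).2 fun u hu ↦ ?_
  obtain ⟨x, rfl⟩ := Φ₁.surjective u
  have hx : (M.map (Int.cast : ℤ → ℝ)) *ᵥ x = intVec 0 := by
    apply Φ.injective
    rw [hF, hu, pM_intVec_zero, map_zero]
  obtain ⟨m, rfl⟩ := exists_eq_intVec_of_isUnimodular Φ₁ Φ hF hB hB₁ h₁ ⟨0, hx⟩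
  rw [intVec_mulVec] at hx
  have hm : m = 0 := mulVec_injective_of_isUnimodular M h₁ (map_mulVec_eq_of_pullbackForm Φ₁ Φ hF hB hB₁) (by
    rw [Matrix.mulVecLin_apply, Matrix.mulVecLin_apply, Matrix.mulVec_zero]
    exact pM_intVec_injective hx)
  rw [hm, pM_intVec_zero, map_zero]

/-! ## §3 «`σ(U₁)` is a direct summand of `U₂`»: the lattice of the image subtorus is `M(Λ₁)` -/

omit [Fintype ι] [DecidableEq ι] in
/-- **Primitivity: `Λ ∩ range M_ℝ = M(Λ₁)`** — the lattice `Λ_Y` of the image subtorus `Y = π(range M_ℝ)` is exactly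
the image lattice. [cite: ClemensGriffiths1972, §3, p. 293] [cite: Lange2023AbelianVarietiesComplex, §1.1.2 Prop. 1.1.10 (a)] -/
theorem subLattice_range_eq_range_mulVecLin (h₁ : B₁.IsUnimodular) :
    subLattice (LinearMap.range (M.map (Int.cast : ℤ → ℝ)).mulVecLin) = LinearMap.range M.mulVecLin := by
  ext m
  rw [mem_subLattice_iff, LinearMap.mem_range, LinearMap.mem_range]
  constructor
  · rintro ⟨x, hx⟩
    rw [Matrix.mulVecLin_apply] at hx
    obtain ⟨m₁, rfl⟩ := exists_eq_intVec_of_isUnimodular Φ₁ Φ hF hB hB₁ h₁ ⟨m, hx⟩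
    rw [intVec_mulVec] at hx
    exact ⟨m₁, pM_intVec_injective hx⟩
  · rintro ⟨m₁, rfl⟩
    exact ⟨intVec m₁, by rw [Matrix.mulVecLin_apply, intVec_mulVec, Matrix.mulVecLin_apply]⟩

omit [Fintype ι] [DecidableEq ι] in
/-- **`B` is unimodular on the lattice `Λ ∩ range M_ℝ` of the image subtorus** («`ℋ₁ = (ℋ₂)_σ`» transported).
[cite: ClemensGriffiths1972, §3, p. 293] -/
theorem isUnimodular_restrict_subLattice_range (h₁ : B₁.IsUnimodular) :
    (B.restrict (subLattice (LinearMap.range (M.map (Int.cast : ℤ → ℝ)).mulVecLin))).IsUnimodular := by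
  rw [subLattice_range_eq_range_mulVecLin Φ₁ Φ hF hB hB₁ h₁]
  exact isUnimodular_restrict_range_mulVecLin M h₁ (map_mulVec_eq_of_pullbackForm Φ₁ Φ hF hB hB₁)

omit [DecidableEq ι₁] [Fintype ι] [DecidableEq ι] in
/-- **«`Im ℋ₂` is also unimodular on `U₁^⊥ = (σ(U₁))^{⊥ Im ℋ₂}`»** on the torus side: for `B` unimodular on `Λ`, `B` is
unimodular on the lattice of the complementary subtorus `(range M_ℝ)^{⊥η}`.
[cite: ClemensGriffiths1972, §3, p. 293] -/
theorem isUnimodular_restrict_subLattice_orthSubspace_range (hΛ : B.IsUnimodular) (h₁ : B₁.IsUnimodular) :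
    (B.restrict (subLattice (orthSubspace Φ η (LinearMap.range (M.map (Int.cast : ℤ → ℝ)).mulVecLin)))).IsUnimodular := by
  classical
  exact isUnimodular_restrict_subLattice_orthSubspace Φ hB (isLatticeSubspace_range_mulVecLin M) hΛ
    (isUnimodular_restrict_subLattice_range Φ₁ Φ hF hB hB₁ h₁)

/-! ## §4 (3.6): `(Im ρ(M), η|) × ((Im ρ(M))^⊥, η|) ⥲ (X, η)` is an isomorphism of polarised tori -/

/-- **`(range M_ℝ, (range M_ℝ)^{⊥η})` is a product pair** for `η` of type `(1,1)`: both are complex lattice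
subspaces, `Λ ⊗ ℝ = V ⊕ V^⊥`, `η(V, V^⊥) = 0` and `Λ = Λ_Y ⊕ Λ_{Y^⊥}` — C–G's `U₂ = σ(U₁) ⊕ U₁^⊥`, `W₂ = σ(W₁) ⊕ W₁^⊥`.
[cite: ClemensGriffiths1972, §3 (3.6), p. 293] -/
theorem isProductPair_range_orthSubspace (h₁ : B₁.IsUnimodular) (h₁₁ : ∀ u v : E, η ![I • u, I • v] = η ![u, v]) :
    IsProductPair Φ η (LinearMap.range (M.map (Int.cast : ℤ → ℝ)).mulVecLin)
      (orthSubspace Φ η (LinearMap.range (M.map (Int.cast : ℤ → ℝ)).mulVecLin)) :=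
  isProductPair_orthSubspace_of_isUnimodular_subLattice Φ hB h₁₁ (isLatticeSubspace_range_mulVecLin M)
    (isComplexSubspace_range_mulVecLin (latticeJ_comm_of_analyticRep Φ₁ Φ hF))
    (isUnimodular_restrict_subLattice_range Φ₁ Φ hF hB hB₁ h₁)

/-- The hypotheses of g12-#1's `exists_isPolarizedIso_addition_orthSubspace_of_isUnimodular_subLattice` hold for the
image: `V = range M_ℝ` and `V^⊥` are complex lattice subspaces (read off the product pair), so that theorem, fed with
`isUnimodular_restrict_subLattice_range`, IS C–G's splitting `(Im ρ(M), η|) × ((Im ρ(M))^⊥, η|) ⥲ (X, η)` of the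
target (bundled in `clemensGriffiths_3_6_morphism` below). [cite: ClemensGriffiths1972, §3 (3.6), p. 293] -/
theorem isLatticeSubspace_isComplexSubspace_range_orthSubspace (h₁ : B₁.IsUnimodular)
    (h₁₁ : ∀ u v : E, η ![I • u, I • v] = η ![u, v]) {V : Submodule ℝ (ι → ℝ)}
    (hVr : V = LinearMap.range (M.map (Int.cast : ℤ → ℝ)).mulVecLin) :
    IsLatticeSubspace V ∧ IsComplexSubspace Φ V ∧ IsLatticeSubspace (orthSubspace Φ η V) ∧
      IsComplexSubspace Φ (orthSubspace Φ η V) := by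
  subst hVr
  have hp := isProductPair_range_orthSubspace Φ₁ Φ hF hB hB₁ h₁ h₁₁
  exact ⟨hp.isLatticeSubspace_left, hp.isComplexSubspace_left, hp.isLatticeSubspace_right, hp.isComplexSubspace_right⟩

/-! ## §5 (3.6): `(W₁, U₁, ℋ₁) ≅ (σ(W₁), σ(U₁), ℋ₂|)` — the corestriction is an isomorphism of polarised tori -/

omit [DecidableEq ι₁] [DecidableEq ι] in
/-- An integer right inverse of the corestriction matrix: `M P = ι_V` (every column of the adapted basis matrix
`ι_V` of `Λ ∩ V` lies in `M(Λ₁) = Λ ∩ V`). Private plumbing. [folklore] -/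
private theorem pM_exists_mul_eq_subtorusMatrix (h₁ : B₁.IsUnimodular) {V : Submodule ℝ (ι → ℝ)}
    (hVr : V = LinearMap.range (M.map (Int.cast : ℤ → ℝ)).mulVecLin) :
    ∃ P : Matrix ι₁ (Fin (subRank V)) ℤ, M * P = subtorusMatrix V := by
  classical
  have hcol : ∀ i : Fin (subRank V), ∃ p : ι₁ → ℤ, M *ᵥ p = subtorusMatrix V *ᵥ Pi.single i 1 := by
    intro i
    have hmem : subtorusMatrix V *ᵥ Pi.single i 1 ∈ subLattice (LinearMap.range (M.map (Int.cast : ℤ → ℝ)).mulVecLin) := by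
      rw [mem_subLattice_iff, ← intVec_mulVec, ← hVr]
      exact subtorusMatrix_mulVec_mem V _
    rw [subLattice_range_eq_range_mulVecLin Φ₁ Φ hF hB hB₁ h₁, LinearMap.mem_range] at hmem
    obtain ⟨p, hp⟩ := hmem
    exact ⟨p, by rw [← hp, Matrix.mulVecLin_apply]⟩
  choose p hp using hcol
  refine ⟨Matrix.of fun j i ↦ p i j, ?_⟩
  ext j i
  have h := congr_fun (hp i) j
  rw [Matrix.mulVec_single_one, Matrix.col_apply] at h
  simpa [Matrix.mul_apply, Matrix.mulVec, dotProduct] using h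

omit [DecidableEq ι] in
/-- **C–G (3.6), the identification of the source with the image: the corestriction
`ρ(R_V M) : (X₁, F^*η) ⥲ (Im ρ(M), η|_{Im ρ(M)})` IS AN ISOMORPHISM OF POLARISED TORI** — a group isomorphism,
holomorphic both ways, whose analytic representation (`F` corestricted to `Φ(V)`) pulls `η|_{Φ(V)}` back to `F^*η`
(`R_V M` has the integer inverse `P`, `M P = ι_V`, because `M(Λ₁) = Λ ∩ V`).
[cite: ClemensGriffiths1972, §3 (3.6), p. 293] [cite: SwinnertonDyer1974AbelianVarieties, Ch. II §7 Thm. 34, pp. 55–57]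
[cite: Lange2023AbelianVarietiesComplex, §1.1.2 Prop. 1.1.10 (a)] -/
theorem exists_isPolarizedIso_corestriction_of_isUnimodular (h₁ : B₁.IsUnimodular) {V : Submodule ℝ (ι → ℝ)}
    (hVr : V = LinearMap.range (M.map (Int.cast : ℤ → ℝ)).mulVecLin) (hV : IsLatticeSubspace V)
    (hVc : IsComplexSubspace Φ V) :
    ∃ h : ComplexTorus Φ₁ ≃+ ComplexTorus (subtorusPeriod Φ V hV hVc),
      IsPolarizedIso Φ₁ (pullbackForm F η) (subtorusPeriod Φ V hV hVc) (pullbackForm (cxSpan Φ V).subtypeL η) h ∧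
        ⇑h = mapMatrix Φ₁ (subtorusPeriod Φ V hV hVc) (retractionMatrix V * M) := by
  obtain ⟨P, hMP⟩ := pM_exists_mul_eq_subtorusMatrix Φ₁ Φ hF hB hB₁ h₁ hVr
  have hM := map_mulVec_eq_of_pullbackForm Φ₁ Φ hF hB hB₁
  have hAB : retractionMatrix V * M * P = 1 := by
    rw [Matrix.mul_assoc, hMP, retractionMatrix_mul_subtorusMatrix]
  have hBA : P * (retractionMatrix V * M) = 1 := by
    -- `M (P R_V M) = ι_V R_V M = M`, and `M` is injective on `Λ₁`
    have hMX : M * (P * (retractionMatrix V * M)) = M := by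
      rw [← Matrix.mul_assoc, hMP, subtorusMatrix_mul_retractionMatrix_mul hVr hV]
    have hinj := mulVec_injective_of_isUnimodular M h₁ hM
    refine Matrix.ext_iff_mulVec.2 fun v ↦ hinj ?_
    rw [Matrix.mulVecLin_apply, Matrix.mulVecLin_apply, Matrix.mulVec_mulVec, hMX, Matrix.one_mulVec]
  obtain ⟨h, hh, hcoe, -⟩ := exists_isPolarizedIso_of_matrix (Φ := Φ₁) (Φ' := subtorusPeriod Φ V hV hVc)
    (η := pullbackForm F η) (η' := pullbackForm (cxSpan Φ V).subtypeL η) hBA hAB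
    (F.codRestrict (cxSpan Φ V) (analyticRep_mem_cxSpan Φ₁ Φ hF hVr))
    (analyticRep_retractionMatrix_mul Φ₁ Φ hF hVr hV hVc) (fun u v ↦ by
      rw [pullbackForm_apply, pullbackForm_apply]
      rfl)
  exact ⟨h, hh, hcoe⟩

/-! ## §6 Clemens–Griffiths (3.6) for a morphism, as printed -/

/-- **Clemens–Griffiths (3.6) for a morphism `σ = ρ(M) : (X₁, F^*η) → (X, η)` of «principally polarized complex tori»**
(`η` of type `(1,1)` with integral lattice form `B` unimodular on `Λ`, `F^*η` with lattice form `B₁` unimodular on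
`Λ₁`; no positivity): with `V = range M_ℝ = σ(W₁)`,
(i) `σ` is injective on the tori; (ii) `(X₁, F^*η) ≅ (Y_V, η|)` as polarised tori (the corestriction);
(iii) `(Y_V, η|) × (Y_V^⊥, η|) ≅ (X, η)` as polarised tori (the addition map); (iv) `B` is unimodular on `Λ ∩ V^⊥`.
[cite: ClemensGriffiths1972, §3 Def. 3.5 and (3.6), p. 293] -/
theorem clemensGriffiths_3_6_morphism (hΛ : B.IsUnimodular) (h₁ : B₁.IsUnimodular)
    (h₁₁ : ∀ u v : E, η ![I • u, I • v] = η ![u, v]) {V : Submodule ℝ (ι → ℝ)}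
    (hVr : V = LinearMap.range (M.map (Int.cast : ℤ → ℝ)).mulVecLin) :
    Injective (mapMatrix Φ₁ Φ M) ∧
      ∃ (hV : IsLatticeSubspace V) (hVc : IsComplexSubspace Φ V) (hW : IsLatticeSubspace (orthSubspace Φ η V))
        (hWc : IsComplexSubspace Φ (orthSubspace Φ η V)),
        (∃ h₁' : ComplexTorus Φ₁ ≃+ ComplexTorus (subtorusPeriod Φ V hV hVc),
            IsPolarizedIso Φ₁ (pullbackForm F η) (subtorusPeriod Φ V hV hVc) (pullbackForm (cxSpan Φ V).subtypeL η) h₁' ∧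
              ⇑h₁' = mapMatrix Φ₁ (subtorusPeriod Φ V hV hVc) (retractionMatrix V * M)) ∧
          (∃ h : ComplexTorus (prodPeriod (subtorusPeriod Φ V hV hVc) (subtorusPeriod Φ (orthSubspace Φ η V) hW hWc)) ≃+
              ComplexTorus Φ,
            IsPolarizedIso (prodPeriod (subtorusPeriod Φ V hV hVc) (subtorusPeriod Φ (orthSubspace Φ η V) hW hWc))
                (prodForm (pullbackForm (cxSpan Φ V).subtypeL η)
                  (pullbackForm (cxSpan Φ (orthSubspace Φ η V)).subtypeL η)) Φ η h ∧
              ⇑h = mapMatrix (prodPeriod (subtorusPeriod Φ V hV hVc) (subtorusPeriod Φ (orthSubspace Φ η V) hW hWc)) Φ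
                (additionMatrix V (orthSubspace Φ η V))) ∧
          (B.restrict (subLattice (orthSubspace Φ η V))).IsUnimodular := by
  obtain ⟨hV, hVc, hW, hWc⟩ :=
    isLatticeSubspace_isComplexSubspace_range_orthSubspace Φ₁ Φ hF hB hB₁ h₁ h₁₁ hVr
  refine ⟨mapMatrix_injective_of_isUnimodular Φ₁ Φ hF hB hB₁ h₁, hV, hVc, hW, hWc,
    exists_isPolarizedIso_corestriction_of_isUnimodular Φ₁ Φ hF hB hB₁ h₁ hVr hV hVc, ?_, ?_⟩
  · subst hVr
    exact exists_isPolarizedIso_addition_orthSubspace_of_isUnimodular_subLattice Φ hB h₁₁ hV hVc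
      (isUnimodular_restrict_subLattice_range Φ₁ Φ hF hB hB₁ h₁) hW hWc
  · subst hVr
    exact isUnimodular_restrict_subLattice_orthSubspace_range Φ₁ Φ hF hB hB₁ hΛ h₁

end Lattice

end ComplexTorus

/-! ## §7 Equal rank: a morphism of principally polarized complex tori of the same dimension is an isomorphism

(Rider.)  When source and target lattices have the SAME rank — one index type `ι` on both sides, `M : Matrix ι ι ℤ` —
C–G's decomposition (3.6) has no room for a complement: `ᵗM G M = G₁` with `det G₁ = ±1` forces `det M = ±1` (and
`det G = ±1`), so `ρ(M)` is an isomorphism of complex tori with integer inverse `M⁻¹`, and an isomorphism of polarised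
tori `(X₁, F^*η) ⥲ (X, η)`. -/

namespace ComplexTorus

section EqualRank

variable {ι : Type*} [Fintype ι] [DecidableEq ι]
  {E₁ E : Type*} [NormedAddCommGroup E₁] [NormedSpace ℂ E₁] [NormedAddCommGroup E] [NormedSpace ℂ E]
  (Φ₁ : (ι → ℝ) ≃L[ℝ] E₁) (Φ : (ι → ℝ) ≃L[ℝ] E) {M : Matrix ι ι ℤ} {F : E₁ →L[ℂ] E}
  {η : E [⋀^Fin 2]→L[ℝ] ℝ} {B : LinearMap.BilinForm ℤ (ι → ℤ)} {B₁ : LinearMap.BilinForm ℤ (ι → ℤ)}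
  (hF : ∀ x, Φ ((M.map (Int.cast : ℤ → ℝ)) *ᵥ x) = F (Φ₁ x))
  (hB : ∀ m n : ι → ℤ, (B m n : ℝ) = η ![Φ (intVec m), Φ (intVec n)])
  (hB₁ : ∀ m n : ι → ℤ, (B₁ m n : ℝ) = pullbackForm F η ![Φ₁ (intVec m), Φ₁ (intVec n)])
include hF hB hB₁

omit hF hB hB₁ in
/-- The Gram matrix in the standard basis is `toMatrix'`. Private plumbing. [folklore] -/
private theorem pM_toMatrix_basisFun (C : LinearMap.BilinForm ℤ (ι → ℤ)) :
    LinearMap.BilinForm.toMatrix (Pi.basisFun ℤ ι) C = LinearMap.BilinForm.toMatrix' C := by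
  ext i j
  rw [LinearMap.BilinForm.toMatrix_apply, LinearMap.BilinForm.toMatrix'_apply, Pi.basisFun_apply, Pi.basisFun_apply]

/-- **`ᵗM G M = G₁`**: the Gram matrices of the integral lattice forms of `η` and `F^*η` in the standard bases.
[cite: ClemensGriffiths1972, §3 Def. 3.5 (`ℋ₁ = (ℋ₂)_σ`), p. 293] [cite: Lange2023AbelianVarietiesComplex, §1.4.2 Prop. 1.4.6 (d)] -/
theorem transpose_mul_toMatrix'_mul_eq :
    Mᵀ * LinearMap.BilinForm.toMatrix' B * M = LinearMap.BilinForm.toMatrix' B₁ := by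
  have hM := map_mulVec_eq_of_pullbackForm Φ₁ Φ hF hB hB₁
  have hcomp : B₁ = B.comp (Matrix.toLin' M) (Matrix.toLin' M) :=
    LinearMap.ext₂ fun m n ↦ by rw [LinearMap.BilinForm.comp_apply, Matrix.toLin'_apply, Matrix.toLin'_apply, hM]
  rw [hcomp, LinearMap.BilinForm.toMatrix'_comp, LinearMap.toMatrix'_toLin']

/-- **Equal rank ⇒ `det M = ±1`**: `det(M)² · det G = det G₁ = ±1` in `ℤ`.
[cite: ClemensGriffiths1972, §3 (3.6) (by dimension, `W₁^⊥ = 0`), p. 293] -/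
theorem isUnit_det_of_isUnimodular_of_rank_eq (h₁ : B₁.IsUnimodular) : IsUnit M.det := by
  have h := (LinearMap.BilinForm.isUnimodular_iff_isUnit_det_holds B₁ (Pi.basisFun ℤ ι)).1 h₁
  rw [pM_toMatrix_basisFun, ← transpose_mul_toMatrix'_mul_eq Φ₁ Φ hF hB hB₁, Matrix.det_mul, Matrix.det_mul,
    Matrix.det_transpose] at h
  exact isUnit_of_mul_isUnit_right h

/-- **Equal rank ⇒ the target form is unimodular too** (`det G = ±1`). [cite: ClemensGriffiths1972, §3 (3.6), p. 293] -/
theorem isUnimodular_of_isUnimodular_of_rank_eq (h₁ : B₁.IsUnimodular) : B.IsUnimodular := by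
  have h := (LinearMap.BilinForm.isUnimodular_iff_isUnit_det_holds B₁ (Pi.basisFun ℤ ι)).1 h₁
  rw [pM_toMatrix_basisFun, ← transpose_mul_toMatrix'_mul_eq Φ₁ Φ hF hB hB₁, Matrix.det_mul, Matrix.det_mul,
    Matrix.det_transpose] at h
  rw [LinearMap.BilinForm.isUnimodular_iff_isUnit_det_holds B (Pi.basisFun ℤ ι), pM_toMatrix_basisFun]
  exact isUnit_of_mul_isUnit_right (isUnit_of_mul_isUnit_left h)

/-- **A morphism `ρ(M) : (X₁, F^*η) → (X, η)` of principally polarized complex tori OF THE SAME DIMENSION (`F^*η`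
unimodular on `Λ₁`, equal lattice ranks) IS AN ISOMORPHISM OF POLARISED TORI**, with inverse `ρ(M⁻¹)`, `M⁻¹` the
integer inverse. [cite: ClemensGriffiths1972, §3 Def. 3.5 and (3.6), p. 293]
[cite: Lange2023AbelianVarietiesComplex, §1.1.2 Prop. 1.1.6 and §3.1.2 Prop. 3.1.4] -/
theorem exists_isPolarizedIso_of_isUnimodular_of_rank_eq (h₁ : B₁.IsUnimodular) :
    ∃ h : ComplexTorus Φ₁ ≃+ ComplexTorus Φ, IsPolarizedIso Φ₁ (pullbackForm F η) Φ η h ∧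
      ⇑h = mapMatrix Φ₁ Φ M ∧ ⇑h.symm = mapMatrix Φ Φ₁ M⁻¹ := by
  have hdet := isUnit_det_of_isUnimodular_of_rank_eq Φ₁ Φ hF hB hB₁ h₁
  exact exists_isPolarizedIso_of_matrix (Φ := Φ₁) (Φ' := Φ) (η := pullbackForm F η) (η' := η)
    (Matrix.nonsing_inv_mul M hdet) (Matrix.mul_nonsing_inv M hdet) F hF fun u v ↦ (pullbackForm_apply F η u v).symm

end EqualRank

end ComplexTorus

end Literature.Geometry.Kaehler

end
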